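import Summits.KontsevichZagierPeriods.KontsevichZagierPeriods.Theorems.TerasomaMultiplicationMultiplicationAccessibleStubMultiplicativityGlueAux2
import Literature.NumberTheory.Transcendental.KZGaussMultiplicationChain

/-!
# `MultiplicationAccessible` (stmt-KontsevichZagierPeriods-12305), line `shifted-family-prime-sieve`,
stub `stub_multiplicativityGlue` — part 4: multiplicativity of the shifted family

The registered sub-goal `stub_multiplicativityGlue_part4`: the shifted Gauss-multiplication family
`GM(n; x, s)` (`∏_{k<n} B(x + k/n, s) = n^{ns} B(nx, ns) ∏_{1≤k<n} B(ks, s)` as an equivalence of Beta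
boxes in the Kontsevich–Zagier rules, `∃`-Beta-box vocabulary of parts 1–2) passes from `n₁ = a+1`,
`n₂ = b+1` to `n = n₁ n₂`, given the Dirichlet re-association move (hypothesis `hBR`, the
neighbouring stub `stub_betaReassoc`). We compute in the formal period ring `P = KZ.FormalPeriodRing`:
a Beta box has class `⟦[pt, κ]⟧ ∏ᵢ ⟦β(αᵢ, βᵢ)⟧` (`toFormalPeriod_box`, from
`KZ.cubeBetaRep_toFormalPeriod_eq_prod`, `KZ.toFormalPeriod_of_constMul`), so equivalences of Beta
boxes are identities of such products (`prod_eq_of_equiv`, `equiv_of_prod_eq`). With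
`g(p, q) = ⟦β(p, q)⟧` the hypotheses read `g(p,q) g(p+q,r) = g(q,r) g(p,q+r)` (`reassoc_eq`) and
`∏_{i≤m} g(x + i/(m+1), s) = ⟦[pt, (m+1)^((m+1)s)]⟧ g((m+1)x, (m+1)s) ∏_{i<m} g((i+1)s, s)` (`gm_eq`);
the chain is cancellation-free: split `k = j + n₂ i` (`prod_shift_split`), `GM(n₁)` on every residue
block `j` (base point `x + j/n`), `GM(n₂)` with parameters `(n₁ x, n₁ s)` on the block heads
`n₁ (x + j/n) = n₁ x + j/n₂`, and the caterpillar `g(W, (a+1)s) ∏_{i<a} g((i+1)s, s) =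
∏_{i≤a} g(W + is, s)` (`absorb_eq`) on every block `j ≥ 1` of the target numbering `k' = i + n₁ j`
(`prod_target_split`).
-/

noncomputable section

open MeasureTheory Set Real
open scoped BigOperators

namespace Summit.KontsevichZagierPeriods.TerasomaMultiplication.MultiplicationAccessible.MultGlue

open Literature.NumberTheory.Transcendental
open Literature.NumberTheory.Transcendental.KZ
open Summit.KontsevichZagierPeriods.MultiplicationAccessible.Negative (boxDom)

/-! ## Beta boxes in the formal period ring `P = KZ.FormalPeriodRing` -/

/-- `0 < i · s` for a nonzero natural number `i` and a positive rational `s`. [folklore] -/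
theorem natCast_mul_pos {i : ℕ} (hi : i ≠ 0) {s : ℚ} (hs : 0 < s) : (0:ℚ) < (i : ℚ) * s :=
  mul_pos (Nat.cast_pos.mpr (Nat.pos_of_ne_zero hi)) hs

/-- A total family of one-variable Beta representations, pinned as
`β(p, q) = [(0,1), t^(p−1)(1−t)^(q−1)]` whenever `p, q > 0` (`KZ.exists_betaRep'`). [folklore] -/
theorem exists_betaFamily : ∃ B : ℚ → ℚ → IntegralRep 1, ∀ p q, 0 < p → 0 < q →
    (B p q).domain = {t | t 0 ∈ Set.Ioo (0:ℝ) 1} ∧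
      (B p q).integrand = fun t => (t 0) ^ ((p:ℝ) - 1) * (1 - t 0) ^ ((q:ℝ) - 1) := by
  classical
  obtain ⟨B₀, -, -⟩ := exists_betaRep' 1 1 one_pos one_pos
  refine ⟨fun p q => if h : 0 < p ∧ 0 < q then Classical.choose (exists_betaRep' p q h.1 h.2)
    else B₀, fun p q hp hq => ?_⟩
  simp only [dif_pos (And.intro hp hq)]
  exact Classical.choose_spec (exists_betaRep' p q hp hq)

/-- **A Beta box is a product of Beta classes in `P`**: a representative `ρ` of the Beta box
`[κ, α, β]` has formal period `⟦ρ⟧ = ⟦[pt, κ]⟧ ∏ᵢ ⟦β(αᵢ, βᵢ)⟧`. [cite: KontsevichZagier2001, §4.1] -/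
theorem toFormalPeriod_box {B : ℚ → ℚ → IntegralRep 1}
    (hB : ∀ p q, 0 < p → 0 < q → (B p q).domain = {t | t 0 ∈ Set.Ioo (0:ℝ) 1} ∧
      (B p q).integrand = fun t => (t 0) ^ ((p:ℝ) - 1) * (1 - t 0) ^ ((q:ℝ) - 1))
    {N : ℕ} {κ : ℝ} (hκ : IsAlgebraic ℚ κ) {α β : Fin N → ℚ} (hα : ∀ i, 0 < α i)
    (hβ : ∀ i, 0 < β i) {ρ : IntegralRep N} (hρd : ρ.domain = boxDom N)
    (hρi : EqOn ρ.integrand (fun z : Fin _ → ℝ => κ *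
      ∏ i, (z i ^ (((α i : ℚ) : ℝ) - 1) * (1 - z i) ^ (((β i : ℚ) : ℝ) - 1))) ρ.domain) :
    toFormalPeriod (of ρ) = toFormalPeriod (of (IntegralRep.unit.constMul κ hκ)) *
      ∏ i, toFormalPeriod (of (B (α i) (β i))) := by
  obtain ⟨r, hrd, hri⟩ := exists_cubeBetaRep α β fun i => ⟨hα i, hβ i⟩
  have h1 : Equivalent ρ (r.constMul κ hκ) :=
    of_sub_of_mem_relations_of_eqOn (by rw [IntegralRep.domain_constMul, hrd, hρd]; rfl)
      fun z hz => by
        have hz' : z ∈ r.domain := by rw [hrd]; rw [hρd] at hz; exact hz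
        simp only [hρi hz, IntegralRep.integrand_constMul, hri hz']
  rw [h1.toFormalPeriod_eq, toFormalPeriod_of_constMul]
  congr 1
  exact cubeBetaRep_toFormalPeriod_eq_prod α β (fun i => ⟨hα i, hβ i⟩) r _ hrd hri
    (fun i => (hB _ _ (hα i) (hβ i)).1) fun i => by
      rw [(hB _ _ (hα i) (hβ i)).2]; exact fun _ _ => rfl

/-- Equivalent Beta boxes have equal products of Beta classes in `P`. [folklore] -/
theorem prod_eq_of_equiv {B : ℚ → ℚ → IntegralRep 1}
    (hB : ∀ p q, 0 < p → 0 < q → (B p q).domain = {t | t 0 ∈ Set.Ioo (0:ℝ) 1} ∧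
      (B p q).integrand = fun t => (t 0) ^ ((p:ℝ) - 1) * (1 - t 0) ^ ((q:ℝ) - 1))
    {N N' : ℕ} {κ κ' : ℝ} (hκ : IsAlgebraic ℚ κ) (hκ' : IsAlgebraic ℚ κ')
    {α β : Fin N → ℚ} {α' β' : Fin N' → ℚ} (hα : ∀ i, 0 < α i) (hβ : ∀ i, 0 < β i)
    (hα' : ∀ i, 0 < α' i) (hβ' : ∀ i, 0 < β' i)
    (h : (∃ (ρ₁ : KZ.IntegralRep _) (ρ₂ : KZ.IntegralRep _),
        (ρ₁.domain = boxDom _ ∧ EqOn ρ₁.integrand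
          (fun z : Fin _ → ℝ => κ *
              ∏ i, (z i ^ (((α i : ℚ) : ℝ) - 1) * (1 - z i) ^ (((β i : ℚ) : ℝ) - 1)))
          ρ₁.domain) ∧
        (ρ₂.domain = boxDom _ ∧ EqOn ρ₂.integrand
          (fun z : Fin _ → ℝ => κ' *
              ∏ i, (z i ^ (((α' i : ℚ) : ℝ) - 1) * (1 - z i) ^ (((β' i : ℚ) : ℝ) - 1)))
          ρ₂.domain) ∧
        KZ.Equivalent ρ₁ ρ₂)) :
    toFormalPeriod (of (IntegralRep.unit.constMul κ hκ)) * ∏ i, toFormalPeriod (of (B (α i) (β i))) =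
      toFormalPeriod (of (IntegralRep.unit.constMul κ' hκ')) *
        ∏ i, toFormalPeriod (of (B (α' i) (β' i))) := by
  obtain ⟨ρ₁, ρ₂, ⟨h1d, h1i⟩, ⟨h2d, h2i⟩, h12⟩ := h
  rw [← toFormalPeriod_box hB hκ hα hβ h1d h1i, ← toFormalPeriod_box hB hκ' hα' hβ' h2d h2i]
  exact h12.toFormalPeriod_eq

/-- Beta boxes with equal products of Beta classes in `P` are equivalent
(`KZ.toFormalPeriod_eq_iff`). [folklore] -/
theorem equiv_of_prod_eq {B : ℚ → ℚ → IntegralRep 1}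
    (hB : ∀ p q, 0 < p → 0 < q → (B p q).domain = {t | t 0 ∈ Set.Ioo (0:ℝ) 1} ∧
      (B p q).integrand = fun t => (t 0) ^ ((p:ℝ) - 1) * (1 - t 0) ^ ((q:ℝ) - 1))
    {N N' : ℕ} {κ κ' : ℝ} (hκ : IsAlgebraic ℚ κ) (hκ' : IsAlgebraic ℚ κ')
    {α β : Fin N → ℚ} {α' β' : Fin N' → ℚ} (hα : ∀ i, 0 < α i) (hβ : ∀ i, 0 < β i)
    (hα' : ∀ i, 0 < α' i) (hβ' : ∀ i, 0 < β' i)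
    (h : toFormalPeriod (of (IntegralRep.unit.constMul κ hκ)) *
        ∏ i, toFormalPeriod (of (B (α i) (β i))) =
      toFormalPeriod (of (IntegralRep.unit.constMul κ' hκ')) *
        ∏ i, toFormalPeriod (of (B (α' i) (β' i)))) :
    (∃ (ρ₁ : KZ.IntegralRep _) (ρ₂ : KZ.IntegralRep _),
        (ρ₁.domain = boxDom _ ∧ EqOn ρ₁.integrand
          (fun z : Fin _ → ℝ => κ *
              ∏ i, (z i ^ (((α i : ℚ) : ℝ) - 1) * (1 - z i) ^ (((β i : ℚ) : ℝ) - 1)))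
          ρ₁.domain) ∧
        (ρ₂.domain = boxDom _ ∧ EqOn ρ₂.integrand
          (fun z : Fin _ → ℝ => κ' *
              ∏ i, (z i ^ (((α' i : ℚ) : ℝ) - 1) * (1 - z i) ^ (((β' i : ℚ) : ℝ) - 1)))
          ρ₂.domain) ∧
        KZ.Equivalent ρ₁ ρ₂) := by
  obtain ⟨ρ₁, h1d, h1i⟩ := exists_betaRep κ hκ α β hα hβ
  obtain ⟨ρ₂, h2d, h2i⟩ := exists_betaRep κ' hκ' α' β' hα' hβ'
  exact ⟨ρ₁, ρ₂, ⟨h1d, h1i⟩, ⟨h2d, h2i⟩, toFormalPeriod_eq_iff.mp (by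
    rw [toFormalPeriod_box hB hκ hα hβ h1d h1i, toFormalPeriod_box hB hκ' hα' hβ' h2d h2i, h])⟩

/-! ## The constants `⟦[pt, κ]⟧` -/

/-- `⟦[pt, κ]⟧` depends only on the value of `κ`. [folklore] -/
theorem ptConst_congr {κ κ' : ℝ} (hκ : IsAlgebraic ℚ κ) (hκ' : IsAlgebraic ℚ κ') (h : κ = κ') :
    toFormalPeriod (of (IntegralRep.unit.constMul κ hκ)) =
      toFormalPeriod (of (IntegralRep.unit.constMul κ' hκ')) := by
  subst h; rfl

/-- `⟦[pt, 1]⟧ = 1`. [folklore] -/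
theorem ptConst_one (h : IsAlgebraic ℚ (1:ℝ)) :
    toFormalPeriod (of (IntegralRep.unit.constMul (1:ℝ) h)) = 1 := by
  rw [← toFormalPeriod_of_unit]
  exact toFormalPeriod_eq_iff.mpr (of_sub_of_mem_relations_of_eqOn rfl fun z _ => by simp)

/-- `⟦[pt, κ₁ κ₂]⟧ = ⟦[pt, κ₁]⟧ ⟦[pt, κ₂]⟧`. [folklore] -/
theorem ptConst_mul {κ₁ κ₂ : ℝ} (h₁ : IsAlgebraic ℚ κ₁) (h₂ : IsAlgebraic ℚ κ₂)
    (h : IsAlgebraic ℚ (κ₁ * κ₂)) :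
    toFormalPeriod (of (IntegralRep.unit.constMul (κ₁ * κ₂) h)) =
      toFormalPeriod (of (IntegralRep.unit.constMul κ₁ h₁)) *
        toFormalPeriod (of (IntegralRep.unit.constMul κ₂ h₂)) := by
  rw [← toFormalPeriod_of_constMul]
  exact toFormalPeriod_eq_iff.mpr
    (of_sub_of_mem_relations_of_eqOn rfl fun z _ => by simp)

/-- `⟦[pt, κ ^ n]⟧ = ⟦[pt, κ]⟧ ^ n`. [folklore] -/
theorem ptConst_pow {κ : ℝ} (hκ : IsAlgebraic ℚ κ) :
    ∀ (n : ℕ) (h : IsAlgebraic ℚ (κ ^ n)), toFormalPeriod (of (IntegralRep.unit.constMul (κ ^ n) h)) =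
      toFormalPeriod (of (IntegralRep.unit.constMul κ hκ)) ^ n
  | 0, h => (ptConst_congr h isAlgebraic_one (pow_zero κ)).trans (by rw [ptConst_one, pow_zero])
  | n + 1, h => (ptConst_congr h ((hκ.pow n).mul hκ) (pow_succ κ n)).trans
      (by rw [ptConst_mul (hκ.pow n) hκ, ptConst_pow hκ n (hκ.pow n), pow_succ])

/-! ## The three hypotheses as identities in `P` -/

/-- **Re-association in `P`** (from the hypothesis `BetaReassoc` of the neighbouring stub
`stub_betaReassoc`): `⟦β(p,q)⟧⟦β(p+q,r)⟧ = ⟦β(q,r)⟧⟦β(p,q+r)⟧`. [folklore] -/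
theorem reassoc_eq {B : ℚ → ℚ → IntegralRep 1}
    (hB : ∀ p q, 0 < p → 0 < q → (B p q).domain = {t | t 0 ∈ Set.Ioo (0:ℝ) 1} ∧
      (B p q).integrand = fun t => (t 0) ^ ((p:ℝ) - 1) * (1 - t 0) ^ ((q:ℝ) - 1))
    (hBR : ∀ (a b c : ℚ), 0 < a → 0 < b → 0 < c → ∀ (r r' : KZ.IntegralRep 2),
      r.domain = {z | ∀ i, z i ∈ Set.Ioo (0:ℝ) 1} →
      Set.EqOn r.integrand (fun z => (z 0) ^ ((a:ℝ) - 1) * (1 - z 0) ^ ((b:ℝ) - 1) *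
        ((z 1) ^ ((a:ℝ) + (b:ℝ) - 1) * (1 - z 1) ^ ((c:ℝ) - 1))) r.domain →
      r'.domain = {z | ∀ i, z i ∈ Set.Ioo (0:ℝ) 1} →
      Set.EqOn r'.integrand (fun z => (z 0) ^ ((b:ℝ) - 1) * (1 - z 0) ^ ((c:ℝ) - 1) *
        ((z 1) ^ ((a:ℝ) - 1) * (1 - z 1) ^ ((b:ℝ) + (c:ℝ) - 1))) r'.domain →
      KZ.Equivalent r r')
    {p q r : ℚ} (hp : 0 < p) (hq : 0 < q) (hr : 0 < r) :
    toFormalPeriod (of (B p q)) * toFormalPeriod (of (B (p + q) r)) =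
      toFormalPeriod (of (B q r)) * toFormalPeriod (of (B p (q + r))) := by
  have h₁ : ∀ i : Fin 2, 0 < ![p, p + q] i ∧ 0 < ![q, r] i :=
    Fin.forall_fin_two.mpr ⟨⟨hp, hq⟩, ⟨add_pos hp hq, hr⟩⟩
  have h₂ : ∀ i : Fin 2, 0 < ![q, p] i ∧ 0 < ![r, q + r] i :=
    Fin.forall_fin_two.mpr ⟨⟨hq, hr⟩, ⟨hp, add_pos hq hr⟩⟩
  obtain ⟨ρ, hρd, hρi⟩ := exists_cubeBetaRep _ _ h₁
  obtain ⟨ρ', hρ'd, hρ'i⟩ := exists_cubeBetaRep _ _ h₂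
  have e := (hBR p q r hp hq hr ρ ρ' hρd (fun z hz => by rw [hρi hz]; simp [Fin.prod_univ_two])
    hρ'd (fun z hz => by rw [hρ'i hz]; simp [Fin.prod_univ_two])).toFormalPeriod_eq
  rw [cubeBetaRep_toFormalPeriod_eq_prod _ _ h₁ ρ (fun i => B (![p, p + q] i) (![q, r] i)) hρd hρi
      (fun i => (hB _ _ (h₁ i).1 (h₁ i).2).1)
      (fun i => by rw [(hB _ _ (h₁ i).1 (h₁ i).2).2]; exact fun _ _ => rfl),
    cubeBetaRep_toFormalPeriod_eq_prod _ _ h₂ ρ' (fun i => B (![q, p] i) (![r, q + r] i)) hρ'd hρ'i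
      (fun i => (hB _ _ (h₂ i).1 (h₂ i).2).1)
      (fun i => by rw [(hB _ _ (h₂ i).1 (h₂ i).2).2]; exact fun _ _ => rfl)] at e
  simpa [Fin.prod_univ_two] using e

/-- **The shifted family in `P`** (from the `∃`-Beta-box form of `GM(m+1; x, s)`):
`∏_{i ≤ m} ⟦β(x + i/(m+1), s)⟧ = ⟦[pt, (m+1)^((m+1)s)]⟧ ⟦β((m+1)x, (m+1)s)⟧ ∏_{i<m} ⟦β((i+1)s, s)⟧`.
[folklore] -/
theorem gm_eq {B : ℚ → ℚ → IntegralRep 1}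
    (hB : ∀ p q, 0 < p → 0 < q → (B p q).domain = {t | t 0 ∈ Set.Ioo (0:ℝ) 1} ∧
      (B p q).integrand = fun t => (t 0) ^ ((p:ℝ) - 1) * (1 - t 0) ^ ((q:ℝ) - 1))
    {a : ℕ}
    (hA : ∀ (x s : ℚ), 0 < x → 0 < s →
        ∃ (ρ₁ : KZ.IntegralRep (a + 1)) (ρ₂ : KZ.IntegralRep (a + 1)),
          (ρ₁.domain = {z | ∀ i, z i ∈ Set.Ioo (0:ℝ) 1} ∧ Set.EqOn ρ₁.integrand (fun z => (1:ℝ) *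
            ∏ i, ((z i) ^ (((x + (i : ℚ) / ((a : ℚ) + 1) : ℚ) : ℝ) - 1) *
              (1 - z i) ^ (((s : ℚ) : ℝ) - 1))) ρ₁.domain) ∧
          (ρ₂.domain = {z | ∀ i, z i ∈ Set.Ioo (0:ℝ) 1} ∧ Set.EqOn ρ₂.integrand (fun z =>
            ((a:ℝ) + 1) ^ (((a:ℝ) + 1) * (s:ℝ)) *
            ∏ i, ((z i) ^ ((((if (i : ℕ) = 0 then ((a : ℚ) + 1) * x else (i : ℚ) * s : ℚ)) : ℝ) - 1) *
              (1 - z i) ^ ((((if (i : ℕ) = 0 then ((a : ℚ) + 1) * s else s : ℚ)) : ℝ) - 1)))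
            ρ₂.domain) ∧
          KZ.Equivalent ρ₁ ρ₂)
    {x s : ℚ} (hx : 0 < x) (hs : 0 < s) :
    ∏ i : Fin (a + 1), toFormalPeriod (of (B (x + (i : ℚ) / ((a : ℚ) + 1)) s)) =
      toFormalPeriod (of (IntegralRep.unit.constMul (((a:ℝ) + 1) ^ (((a:ℝ) + 1) * (s:ℝ)))
        (isAlgebraic_gaussConst a s))) * (toFormalPeriod (of (B (((a : ℚ) + 1) * x) (((a : ℚ) + 1) * s))) *
        ∏ i : Fin a, toFormalPeriod (of (B (((i : ℚ) + 1) * s) s))) := by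
  have h := prod_eq_of_equiv hB isAlgebraic_one (isAlgebraic_gaussConst a s)
    (α := fun i : Fin (a + 1) => x + (i : ℚ) / ((a : ℚ) + 1)) (β := fun _ => s)
    (α' := fun i : Fin (a + 1) => if (i : ℕ) = 0 then ((a : ℚ) + 1) * x else (i : ℚ) * s)
    (β' := fun i : Fin (a + 1) => if (i : ℕ) = 0 then ((a : ℚ) + 1) * s else s)
    (fun i => by positivity) (fun _ => hs)
    (fun i => by split_ifs with h; exacts [by positivity, natCast_mul_pos h hs])
    (fun i => by split_ifs <;> positivity) (hA x s hx hs)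
  rw [ptConst_one, one_mul] at h
  rw [h, Fin.prod_univ_succ]
  simp [Fin.val_succ]

/-- **The caterpillar in `P`**: `⟦β(W, (a+1)s)⟧ ∏_{i<a} ⟦β((i+1)s, s)⟧ = ∏_{i≤a} ⟦β(W + is, s)⟧`
(`a` re-associations). [folklore] -/
theorem absorb_eq {B : ℚ → ℚ → IntegralRep 1}
    (hRe : ∀ p q r : ℚ, 0 < p → 0 < q → 0 < r →
      toFormalPeriod (of (B p q)) * toFormalPeriod (of (B (p + q) r)) =
        toFormalPeriod (of (B q r)) * toFormalPeriod (of (B p (q + r))))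
    {W s : ℚ} (hW : 0 < W) (hs : 0 < s) : ∀ a : ℕ,
    toFormalPeriod (of (B W (((a : ℚ) + 1) * s))) *
        ∏ i : Fin a, toFormalPeriod (of (B (((i : ℚ) + 1) * s) s)) =
      ∏ i : Fin (a + 1), toFormalPeriod (of (B (W + (i : ℚ) * s) s))
  | 0 => by simp
  | a + 1 => by
    rw [Fin.prod_univ_castSucc, Fin.prod_univ_castSucc (n := a + 1)]
    simp only [Fin.val_castSucc, Fin.val_last, Nat.cast_add, Nat.cast_one]
    rw [← absorb_eq hRe hW hs a]
    have key := hRe W (((a : ℚ) + 1) * s) s hW (by positivity) hs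
    rw [show ((a : ℚ) + 1) * s + s = ((a : ℚ) + 1 + 1) * s by ring] at key
    linear_combination (-(∏ i : Fin a, toFormalPeriod (of (B (((i : ℚ) + 1) * s) s)))) * key

/-! ## Re-indexing `Fin (n₁ n₂)` by blocks -/

/-- `k = (k mod n) + n (k div n)` for `k : Fin (m n)`. [folklore] -/
theorem val_eq_modNat_add_mul_divNat {m n : ℕ} (k : Fin (m * n)) :
    (k : ℕ) = (k.modNat : ℕ) + n * (k.divNat : ℕ) := by
  rw [Fin.coe_modNat, Fin.coe_divNat, Nat.mod_add_div]

/-- **Splitting the shifted family into residue blocks**: with `k = j + n₂ i`,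
`∏_{k < n₁n₂} ⟦β(x + k/(n₁n₂), s)⟧ = ∏_{j<n₂} ∏_{i<n₁} ⟦β((x + j/(n₁n₂)) + i/n₁, s)⟧`. [folklore] -/
theorem prod_shift_split (B : ℚ → ℚ → IntegralRep 1) (a b : ℕ) (x s : ℚ) :
    ∏ k : Fin ((a + 1) * (b + 1)),
        toFormalPeriod (of (B (x + (k : ℚ) / (((a : ℚ) + 1) * ((b : ℚ) + 1))) s)) =
      ∏ j : Fin (b + 1), ∏ i : Fin (a + 1), toFormalPeriod (of
        (B (x + (j : ℚ) / (((a : ℚ) + 1) * ((b : ℚ) + 1)) + (i : ℚ) / ((a : ℚ) + 1)) s)) := by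
  rw [Finset.prod_comm, ← Fintype.prod_prod_type']
  refine Fintype.prod_equiv finProdFinEquiv.symm _ _ fun k => ?_
  rw [finProdFinEquiv_symm_apply]
  refine congrArg (fun p => toFormalPeriod (of (B p s))) ?_
  rw [show ((k : ℕ) : ℚ) = (k.modNat : ℚ) + ((b : ℚ) + 1) * (k.divNat : ℚ) by
    exact_mod_cast val_eq_modNat_add_mul_divNat k]
  field_simp; ring

/-- **Splitting the target into blocks**: with `k' = i + n₁ j ∈ Fin (n₂ n₁)`, the product
`⟦β(X, Y)⟧ ∏_{1 ≤ k' < n₂n₁} ⟦β(k' s, s)⟧` is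
`(⟦β(X, Y)⟧ ∏_{i<a} ⟦β((i+1)s, s)⟧) ∏_{j<b} ∏_{i≤a} ⟦β((j+1) n₁ s + i s, s)⟧`. [folklore] -/
theorem prod_target_split (B : ℚ → ℚ → IntegralRep 1) (a b : ℕ) (X Y s : ℚ) :
    ∏ k : Fin ((b + 1) * (a + 1)), toFormalPeriod (of
        (B (if (k : ℕ) = 0 then X else (k : ℚ) * s) (if (k : ℕ) = 0 then Y else s))) =
      (toFormalPeriod (of (B X Y)) *
          ∏ i : Fin a, toFormalPeriod (of (B (((i : ℚ) + 1) * s) s))) *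
        ∏ j : Fin b, ∏ i : Fin (a + 1), toFormalPeriod (of
          (B (((j : ℚ) + 1) * (((a : ℚ) + 1) * s) + (i : ℚ) * s) s)) := by
  rw [Fintype.prod_equiv finProdFinEquiv.symm
      (fun k : Fin ((b + 1) * (a + 1)) => toFormalPeriod (of
        (B (if (k : ℕ) = 0 then X else (k : ℚ) * s) (if (k : ℕ) = 0 then Y else s))))
      (fun p : Fin (b + 1) × Fin (a + 1) => toFormalPeriod (of
        (B (if (p.2 : ℕ) + (a + 1) * (p.1 : ℕ) = 0 then X
            else (((p.2 : ℕ) + (a + 1) * (p.1 : ℕ) : ℕ) : ℚ) * s)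
          (if (p.2 : ℕ) + (a + 1) * (p.1 : ℕ) = 0 then Y else s))))
      fun k => by rw [finProdFinEquiv_symm_apply, ← val_eq_modNat_add_mul_divNat k],
    Fintype.prod_prod_type, Fin.prod_univ_succ, Fin.prod_univ_succ]
  congr 1
  · simp [Fin.val_succ]
  · refine Finset.prod_congr rfl fun j _ => Finset.prod_congr rfl fun i _ => ?_
    have h : (i : ℕ) + (a + 1) * ((j.succ : Fin (b + 1)) : ℕ) ≠ 0 := by simp [Fin.val_succ]
    rw [if_neg h, if_neg h]
    refine congrArg (fun p => toFormalPeriod (of (B p s))) ?_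
    push_cast [Fin.val_succ]
    ring

end Summit.KontsevichZagierPeriods.TerasomaMultiplication.MultiplicationAccessible.MultGlue

namespace Summit.KontsevichZagierPeriods.TerasomaMultiplication.MultiplicationAccessible

open Literature.NumberTheory.Transcendental
open Literature.NumberTheory.Transcendental.KZ

/-- **Registered sub-goal `stub_multiplicativityGlue_part4` of stub `stub_multiplicativityGlue`**
(multiplicativity in `n` of the shifted Gauss-multiplication family inside the Kontsevich–Zagier
rules): given the Dirichlet re-association move and `GM(n; ·, ·)` at `n₁ = a + 1` and `n₂ = b + 1`,
`[(0,1)^n, ∏_k z_k^(x+k/n−1)(1−z_k)^(s−1)] ∼ [(0,1)^n, n₂^(n₂ n₁ s) (n₁^(n₁ s))^(n₂) z₀^(nx−1)(1−z₀)^(ns−1)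
∏_{k≥1} z_k^(ks−1)(1−z_k)^(s−1)]` for `n = n₁ n₂`, computed in the formal period ring. [folklore] -/
theorem stub_multiplicativityGlue_part4 :
    (∀ (a b c : ℚ), 0 < a → 0 < b → 0 < c → ∀ (r r' : KZ.IntegralRep 2),
      r.domain = {z | ∀ i, z i ∈ Set.Ioo (0:ℝ) 1} →
      Set.EqOn r.integrand (fun z => (z 0) ^ ((a:ℝ) - 1) * (1 - z 0) ^ ((b:ℝ) - 1) *
        ((z 1) ^ ((a:ℝ) + (b:ℝ) - 1) * (1 - z 1) ^ ((c:ℝ) - 1))) r.domain →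
      r'.domain = {z | ∀ i, z i ∈ Set.Ioo (0:ℝ) 1} →
      Set.EqOn r'.integrand (fun z => (z 0) ^ ((b:ℝ) - 1) * (1 - z 0) ^ ((c:ℝ) - 1) *
        ((z 1) ^ ((a:ℝ) - 1) * (1 - z 1) ^ ((b:ℝ) + (c:ℝ) - 1))) r'.domain →
      KZ.Equivalent r r') →
    ∀ (a b : ℕ),
      (∀ (x s : ℚ), 0 < x → 0 < s →
        ∃ (ρ₁ : KZ.IntegralRep (a + 1)) (ρ₂ : KZ.IntegralRep (a + 1)),
          (ρ₁.domain = {z | ∀ i, z i ∈ Set.Ioo (0:ℝ) 1} ∧ Set.EqOn ρ₁.integrand (fun z => (1:ℝ) *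
            ∏ i, ((z i) ^ (((x + (i : ℚ) / ((a : ℚ) + 1) : ℚ) : ℝ) - 1) *
              (1 - z i) ^ (((s : ℚ) : ℝ) - 1))) ρ₁.domain) ∧
          (ρ₂.domain = {z | ∀ i, z i ∈ Set.Ioo (0:ℝ) 1} ∧ Set.EqOn ρ₂.integrand (fun z =>
            ((a:ℝ) + 1) ^ (((a:ℝ) + 1) * (s:ℝ)) *
            ∏ i, ((z i) ^ ((((if (i : ℕ) = 0 then ((a : ℚ) + 1) * x else (i : ℚ) * s : ℚ)) : ℝ) - 1) *
              (1 - z i) ^ ((((if (i : ℕ) = 0 then ((a : ℚ) + 1) * s else s : ℚ)) : ℝ) - 1)))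
            ρ₂.domain) ∧
          KZ.Equivalent ρ₁ ρ₂) →
      (∀ (x s : ℚ), 0 < x → 0 < s →
        ∃ (ρ₁ : KZ.IntegralRep (b + 1)) (ρ₂ : KZ.IntegralRep (b + 1)),
          (ρ₁.domain = {z | ∀ i, z i ∈ Set.Ioo (0:ℝ) 1} ∧ Set.EqOn ρ₁.integrand (fun z => (1:ℝ) *
            ∏ i, ((z i) ^ (((x + (i : ℚ) / ((b : ℚ) + 1) : ℚ) : ℝ) - 1) *
              (1 - z i) ^ (((s : ℚ) : ℝ) - 1))) ρ₁.domain) ∧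
          (ρ₂.domain = {z | ∀ i, z i ∈ Set.Ioo (0:ℝ) 1} ∧ Set.EqOn ρ₂.integrand (fun z =>
            ((b:ℝ) + 1) ^ (((b:ℝ) + 1) * (s:ℝ)) *
            ∏ i, ((z i) ^ ((((if (i : ℕ) = 0 then ((b : ℚ) + 1) * x else (i : ℚ) * s : ℚ)) : ℝ) - 1) *
              (1 - z i) ^ ((((if (i : ℕ) = 0 then ((b : ℚ) + 1) * s else s : ℚ)) : ℝ) - 1)))
            ρ₂.domain) ∧
          KZ.Equivalent ρ₁ ρ₂) →
      (∀ (x s : ℚ), 0 < x → 0 < s →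
        ∃ (ρ₁ : KZ.IntegralRep ((a + 1) * (b + 1))) (ρ₂ : KZ.IntegralRep ((b + 1) * (a + 1))),
          (ρ₁.domain = {z | ∀ i, z i ∈ Set.Ioo (0:ℝ) 1} ∧ Set.EqOn ρ₁.integrand (fun z => (1:ℝ) *
            ∏ k, ((z k) ^ (((x + (k : ℚ) / (((a : ℚ) + 1) * ((b : ℚ) + 1)) : ℚ) : ℝ) - 1) *
              (1 - z k) ^ (((s : ℚ) : ℝ) - 1))) ρ₁.domain) ∧
          (ρ₂.domain = {z | ∀ i, z i ∈ Set.Ioo (0:ℝ) 1} ∧ Set.EqOn ρ₂.integrand (fun z =>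
            ((1:ℝ) ^ (b + 1) * (((b:ℝ) + 1) ^ (((b:ℝ) + 1) * (((((a:ℚ) + 1) * s : ℚ)) : ℝ)) *
              ((((a:ℝ) + 1) ^ (((a:ℝ) + 1) * (s:ℝ))) ^ (b + 1) * 1))) *
            ∏ k, ((z k) ^ ((((if (k : ℕ) = 0 then ((b : ℚ) + 1) * (((a : ℚ) + 1) * x)
                else (k : ℚ) * s : ℚ)) : ℝ) - 1) *
              (1 - z k) ^ ((((if (k : ℕ) = 0 then ((b : ℚ) + 1) * (((a : ℚ) + 1) * s)
                else s : ℚ)) : ℝ) - 1))) ρ₂.domain) ∧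
          KZ.Equivalent ρ₁ ρ₂) := by
  intro hBR a b hA hB x s hx hs
  obtain ⟨B, hBf⟩ := MultGlue.exists_betaFamily
  have hK : IsAlgebraic ℚ ((1:ℝ) ^ (b + 1) *
      (((b:ℝ) + 1) ^ (((b:ℝ) + 1) * (((((a:ℚ) + 1) * s : ℚ)) : ℝ)) *
        ((((a:ℝ) + 1) ^ (((a:ℝ) + 1) * (s:ℝ))) ^ (b + 1) * 1))) :=
    (isAlgebraic_one.pow _).mul ((MultGlue.isAlgebraic_gaussConst b _).mul
      (((MultGlue.isAlgebraic_gaussConst a s).pow _).mul isAlgebraic_one))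
  refine MultGlue.equiv_of_prod_eq hBf isAlgebraic_one hK
    (α := fun k : Fin ((a + 1) * (b + 1)) => x + (k : ℚ) / (((a : ℚ) + 1) * ((b : ℚ) + 1)))
    (β := fun _ => s)
    (α' := fun k : Fin ((b + 1) * (a + 1)) =>
      if (k : ℕ) = 0 then ((b : ℚ) + 1) * (((a : ℚ) + 1) * x) else (k : ℚ) * s)
    (β' := fun k : Fin ((b + 1) * (a + 1)) =>
      if (k : ℕ) = 0 then ((b : ℚ) + 1) * (((a : ℚ) + 1) * s) else s)
    (fun k => by positivity) (fun _ => hs)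
    (fun k => by split_ifs with h; exacts [by positivity, MultGlue.natCast_mul_pos h hs])
    (fun k => by split_ifs <;> positivity) ?_
  -- LHS: `GM(n₁)` on the residue blocks, then `GM(n₂)` on the block heads
  rw [MultGlue.ptConst_one, one_mul, MultGlue.prod_shift_split B a b x s,
    MultGlue.prod_target_split B a b, Finset.prod_congr rfl fun (j : Fin (b + 1)) _ =>
      MultGlue.gm_eq hBf hA (x := x + (j : ℚ) / (((a : ℚ) + 1) * ((b : ℚ) + 1))) (by positivity) hs,
    Finset.prod_mul_distrib, Finset.prod_mul_distrib, Finset.prod_const, Finset.prod_const,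
    Finset.card_univ, Fintype.card_fin,
    Finset.prod_congr rfl fun (j : Fin (b + 1)) _ =>
      congrArg (fun p => toFormalPeriod (of (B p (((a : ℚ) + 1) * s))))
        (show ((a : ℚ) + 1) * (x + (j : ℚ) / (((a : ℚ) + 1) * ((b : ℚ) + 1))) =
          ((a : ℚ) + 1) * x + (j : ℚ) / ((b : ℚ) + 1) by field_simp),
    MultGlue.gm_eq hBf hB (x := ((a : ℚ) + 1) * x) (s := ((a : ℚ) + 1) * s) (by positivity)
      (by positivity)]
  -- RHS: undo the caterpillar on every block `j ≥ 1`; then compare the constants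
  rw [← Finset.prod_congr rfl fun (j : Fin b) _ =>
      MultGlue.absorb_eq (fun p q r => MultGlue.reassoc_eq hBf hBR)
      (W := ((j : ℚ) + 1) * (((a : ℚ) + 1) * s)) (by positivity) hs a,
    Finset.prod_mul_distrib, Finset.prod_const, Finset.card_univ, Fintype.card_fin,
    MultGlue.ptConst_congr hK ((MultGlue.isAlgebraic_gaussConst b (((a : ℚ) + 1) * s)).mul
      ((MultGlue.isAlgebraic_gaussConst a s).pow (b + 1))) (by ring),
    MultGlue.ptConst_mul (MultGlue.isAlgebraic_gaussConst b (((a : ℚ) + 1) * s))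
      ((MultGlue.isAlgebraic_gaussConst a s).pow (b + 1)),
    MultGlue.ptConst_pow (MultGlue.isAlgebraic_gaussConst a s) (b + 1)]
  ring

end Summit.KontsevichZagierPeriods.TerasomaMultiplication.MultiplicationAccessible

end
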